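import Mathlib
import Summits.Ventures.HodgeRepro2.T5ContinuousCharacterExtension
import Summits.Ventures.HodgeRepro2.T5RamifiedCharacterInflation

/-!
# Descent and extension of a continuous character from an open subgroup, trivial on a
  prescribed subgroup (the assembly step of Theorem N5.T3)

Theorem N5.T3 of `route/TIER5.md` §N5.11.6 builds each automorphic character `χ_i` in two
steps: «`χ⁰_i` descends to the open subgroup `H := E¹(F)·G_T` (`χ(γg) := χ⁰_i(g)`) iff
`χ⁰_i|_{μ(E)} = 1`» (with `E¹(F) ∩ G_T = μ(E)`), and «`H` is an open subgroup of finite index …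
so the character extends to an automorphic character `χ_i` of `E¹(𝔸)/E¹(F)` (A3b)». Both
steps are one statement about an abelian topological group `G` with an OPEN subgroup `U`
(`G_T`) and a subgroup `F` (`E¹(F)`): a continuous character `χ` of `U` trivial on `U ∩ F`
extends to a CONTINUOUS character of `G` trivial on `F`. Neither finite index nor compactness
is needed — the algebraic extension is the gluing lemma of `T5RamifiedCharacterInflation`
(second isomorphism theorem + Baer), and continuity follows because the extension agrees with
`χ` on the open subgroup `U` (`T5ContinuousCharacterExtension`).

* `exists_continuous_extension_of_eq_one_on_inf`: the statement for any ℤ-rootable topological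
  target `Q` (`ℂˣ`, `Circle`);
* `exists_continuous_extension_units_of_eq_one_on_inf`, `…_circle_…`: the `ℂˣ`- and
  `Circle`-valued forms (the prose's «character» / «unitary character»).

Declaration per README §8(d): «uses an L-value-free non-vanishing device: NO».
-/

namespace Summit.Ventures.HodgeRepro2.T5ContinuousDescent

variable {G : Type*} [CommGroup G] [TopologicalSpace G] [IsTopologicalGroup G]

/-- A continuous character `χ` of an OPEN subgroup `U` of an abelian topological group, trivial
on `U ∩ F`, extends to a continuous character of the whole group trivial on `F`. -/
theorem exists_continuous_extension_of_eq_one_on_inf {Q : Type*} [CommGroup Q]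
    [TopologicalSpace Q] [ContinuousMul Q] [RootableBy Q ℤ] (U F : Subgroup G)
    (hU : IsOpen (U : Set G)) (χ : U →* Q) (hχc : Continuous χ)
    (hχ : ∀ x : U, (x : G) ∈ F → χ x = 1) :
    ∃ ψ : G →* Q, Continuous ψ ∧ (∀ x : U, ψ x = χ x) ∧ ∀ f ∈ F, ψ f = 1 := by
  obtain ⟨ψ, h1, h2⟩ :=
    T5RamifiedCharacterInflation.exists_extension_of_eq_one_on_inf U F χ hχ
  refine ⟨ψ, ?_, h1, h2⟩
  refine T5ContinuousCharacterExtension.continuous_of_continuousOn_open_subgroup U hU ψ ?_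
  -- on `U`, `ψ` is `χ`, which is continuous
  rw [continuousOn_iff_continuous_restrict]
  have e : (U : Set G).restrict ψ = χ := by
    funext g
    exact h1 g
  rw [e]
  exact hχc

/-- The `ℂˣ`-valued form («a character of `E¹(𝔸)` trivial on `E¹(F)` extending `χ⁰`»). -/
theorem exists_continuous_extension_units_of_eq_one_on_inf (U F : Subgroup G)
    (hU : IsOpen (U : Set G)) (χ : U →* ℂˣ) (hχc : Continuous χ)
    (hχ : ∀ x : U, (x : G) ∈ F → χ x = 1) :
    ∃ ψ : G →* ℂˣ, Continuous ψ ∧ (∀ x : U, ψ x = χ x) ∧ ∀ f ∈ F, ψ f = 1 :=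
  exists_continuous_extension_of_eq_one_on_inf U F hU χ hχc hχ

/-- The unitary (`Circle`-valued) form. -/
theorem exists_continuous_extension_circle_of_eq_one_on_inf (U F : Subgroup G)
    (hU : IsOpen (U : Set G)) (χ : U →* Circle) (hχc : Continuous χ)
    (hχ : ∀ x : U, (x : G) ∈ F → χ x = 1) :
    ∃ ψ : G →* Circle, Continuous ψ ∧ (∀ x : U, ψ x = χ x) ∧ ∀ f ∈ F, ψ f = 1 :=
  exists_continuous_extension_of_eq_one_on_inf U F hU χ hχc hχ

end Summit.Ventures.HodgeRepro2.T5ContinuousDescent
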